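import Literature.AlgebraicGeometry.Motives.FaltingsECSubspacesHomOfAbelianVarietyProofs
import Literature.NumberTheory.EllipticCurves.IsogenyDualInseparableProofs
import HarnessLib

/-!
# Faltings' Korollar 2 for elliptic curves by Tate's graph argument: bridge, Finiteness I, quotients

D-0014 keeps `Literature/` sorry-free by stating cited results as named facts `def X : Prop`.
The named fact `Literature.AlgebraicGeometry.Motives.isIsogenous_iff_exists_tateModule_hom_ne_zero W W' ℓ`
(`FaltingsEC`) is G. Faltings, *Endlichkeitssätze für abelsche Varietäten über Zahlkörpern*,
Invent. Math. 73 (1983), §5, Korollar 2, (i) ⇔ (ii), for elliptic curves: two elliptic curves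
`E, E'` over a number field `K` are isogenous over `K` iff there is a non-zero `Γ_K`-equivariant
`ℤ_ℓ`-linear map `T_ℓ E → T_ℓ E'` (English translation: Cornell–Silverman, *Arithmetic
Geometry*, Ch. II, §5, Corollary 2; Silverman, *AEC*, Isogeny Theorem III.7.7). In print,
"(i) ⇔ (ii) follow from Theorem 4", and Theorem 4 / Korollar 1 are proved (§5) from
**Finiteness I** (§6 Satz 6 with Zarhin's trick) by Tate's argument (J. Tate, Invent. Math. 2
(1966), §2; Milne, *Abelian Varieties* (2008), Ch. IV, Lemma 2.4, Thm. 2.5).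

`FaltingsECSubspacesHomOfAbelianVarietyProofs` reduces the fact to three named facts of the
theory of abelian varieties — `nonempty_abelianVarietyBridgeFull W W'` (elliptic curves are
one-dimensional abelian varieties, with compatibilities for all four `Hom`-groups of the pair),
`AbelianVariety.finite_isoClasses_isogenous` (Finiteness I) and
`AbelianVariety.exists_quotient_isogeny` (quotients by finite stable subgroups) — through
Faltings' Korollar 1, i.e. through the block decomposition of `End(A × A') ⊗ ℚ_ℓ`
(`isIsogenous_iff_exists_tateModule_hom_ne_zero_of_finitenessI_quotient`).

This file records that **Korollar 2 alone needs less**: Tate's *graph argument* for the abelian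
surface `A ⊞ A'` — proved in the tree over any field
(`Literature.AlgebraicGeometry.Motives.isIsogenous_of_tateModule_hom_ne_zero_of_tateSubspaceRealization`,
`FaltingsECOfAbelianVarietyFiniteProofs`: a non-zero equivariant `T_ℓ E → T_ℓ E'` and the lattice
lemma for `A ⊞ A'` give `Hom_K(A, A') ≠ 0 ∨ Hom_K(A', A) ≠ 0`, "no double centraliser, no
semisimplicity of `End ⊗ ℚ_ℓ`, no saturation") — uses of the bridge only that non-zero
homomorphisms `A → A'` and `A' → A` are isogenies of the curves, i.e. the *symmetric* bridge fact
`nonempty_abelianVarietyBridge_symm W W'` (`AbelianVarietyBridge`; implied by the full one,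
`nonempty_abelianVarietyBridge_symm_of_full`), and the dual isogeny for `(E', E)`, a theorem of
the tree over any field (`Isogeny.nonempty_symm_holds_of_isElliptic`, *AEC* III.6.1). Over a
number field the lattice lemma for the bridged surface comes from Finiteness I
(`tateSubspaceRealization_of_finitenessI`, `TateAbelianLatticeOfFinitenessProofs`) with `T_ℓ(A ⊞ A')`
free of finite rank proved from the curves (`module_free_tateModule_pt`,
`module_finite_tateModule_pt` of `FaltingsECSubspacesHomOfAbelianVarietyProofs`) and products of
abelian varieties a theorem (`AbelianVariety.exists_binaryBicone_total_holds`). This is the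
number-field counterpart of
`isIsogenous_of_finite_iff_exists_tateModule_hom_ne_zero_of_tateSubspaceRealization` (finite
fields, `FaltingsECOfAbelianVarietyFiniteProofs`).

## Contents (all proved; no definitions, no new named facts)

* `isIsogenous_iff_exists_tateModule_hom_ne_zero_of_bridge_of_tateSubspaceRealization`: the
  named fact from bridge data `B` with the reverse `Hom`-compatibility, a total bicone `b` on
  `(B.A, B.A')` and the lattice lemma for `b.pt`.
* `isIsogenous_iff_exists_tateModule_hom_ne_zero_of_finitenessI_of_bridge_symm`: the named fact
  from `nonempty_abelianVarietyBridge_symm W W'`, `finite_isoClasses_isogenous P` and the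
  lattice/isogeny dictionary `exists_isogeny_range_tateModuleMap_eq P ℓ` (all `P`).
* `isIsogenous_iff_exists_tateModule_hom_ne_zero_of_finitenessI_of_bridge_symm_of_quotient`: the
  same with the dictionary supplied by the quotient fact `exists_quotient_isogeny P ℓ`. With the
  discharges of `nonempty_abelianVarietyBridge_symm`, `finite_isoClasses_isogenous` and
  `exists_quotient_isogeny` this is `isIsogenous_iff_exists_tateModule_hom_ne_zero_holds`; of the
  three, Finiteness I is Faltings' theorem itself (heights, `p`-divisible groups, Hodge–Tate,
  Raynaud), the one deep input, as in print.

## References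

* [Faltings1983Endlichkeit] G. Faltings, Invent. Math. 73 (1983), 349–366, §5 (Sätze 3–4 and
  their proof, Korollar 1–2), §6 Satz 6.
* [Faltings1986FinitenessTranslation] English translation, Cornell–Silverman (eds.),
  *Arithmetic Geometry*, Springer 1986, Ch. II, §5, Theorems 3–4, Corollaries 1–2 (held:
  `book:cornellnd-arithmetic-geometry`, PDF pp. 89–90; read).
* [MilneAV2008] J. S. Milne, *Abelian Varieties* (2008), Ch. IV, Thm. 1.1, Lemma 2.4, Thm. 2.5.
* [Tate1966Endomorphisms] J. Tate, Invent. Math. 2 (1966), §2 and Theorem 1.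
* [SilvermanAEC2009] J. H. Silverman, *The Arithmetic of Elliptic Curves*, 2nd ed., III.6.1,
  III.7.4, Isogeny Theorem III.7.7.

## Design choices

Theorems only; `noncomputable section`; universe-monomorphic `K : Type u`; bridge data, bicones
and the abelian-variety facts threaded exactly as in `FaltingsECOfAbelianVarietyLatticeProofs`
and `FaltingsECSubspacesHomOfAbelianVarietyProofs` (facts quantified over all abelian varieties
over `K` in the final statements, the bridged varieties being bound inside the proof).
-/

noncomputable section

universe u

open CategoryTheory CategoryTheory.Limits

namespace Literature.AlgebraicGeometry.Motives

open WeierstrassCurve AbelianVariety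

variable {K : Type u} [Field K] {W W' : WeierstrassCurve K} (ℓ : ℕ) [Fact ℓ.Prime]

variable (W W') in
/-- **Faltings' Korollar 2 for `(E, E')` from bridge data, a biproduct and the lattice lemma for
its vertex (graph argument).** Let `B` be bridge data for `(W, W')` under which non-zero
homomorphisms `B.A' → B.A` yield isogenies `E' → E` as well (`hB`), `b` a bicone on `(B.A, B.A')`
with `fst ≫ inl + snd ≫ inr = 𝟙`, and assume Tate's lattice lemma for `b.pt` whenever `K` is a
number field (`hW`). Then the named fact `isIsogenous_iff_exists_tateModule_hom_ne_zero W W' ℓ`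
holds: (→) is the tree's unconditional `exists_tateModule_hom_ne_zero_of_isIsogenous`
(*AEC* III.7.4; `ℓ ≠ char K = 0`); (←) is the graph argument
`isIsogenous_of_tateModule_hom_ne_zero_of_tateSubspaceRealization` (any field), the dual isogeny
for `(E', E)` being the theorem `Isogeny.nonempty_symm_holds_of_isElliptic` (*AEC* III.6.1).
Faltings 1983, §5, Korollar 2; Tate 1966, §2. [cite: Faltings1983Endlichkeit, §5 Korollar 2 (i)⇔(ii)] -/
theorem isIsogenous_iff_exists_tateModule_hom_ne_zero_of_bridge_of_tateSubspaceRealization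
    (B : AbelianVarietyBridge W W')
    (hB : ∀ f : B.A' ⟶ B.A, f ≠ 0 → W'.IsIsogenous W)
    (b : BinaryBicone B.A B.A') (hb : b.fst ≫ b.inl + b.snd ≫ b.inr = 𝟙 b.pt)
    (hW : ∀ [NumberField K], tateSubspaceRealization b.pt ℓ) :
    isIsogenous_iff_exists_tateModule_hom_ne_zero W W' ℓ := by
  intro _ _ _
  have hℓ : (ℓ : K) ≠ 0 := Nat.cast_ne_zero.mpr (Fact.out : ℓ.Prime).ne_zero
  refine ⟨exists_tateModule_hom_ne_zero_of_isIsogenous ℓ hℓ, fun ⟨f, hf0, hf⟩ ↦ ?_⟩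
  exact isIsogenous_of_tateModule_hom_ne_zero_of_tateSubspaceRealization W W' ℓ b hb hW B.e
    B.e_smul B.e' B.e'_smul (fun g hg ↦ isIsogenous_of_exists_isogeny_comp B.exists_isogeny g hg)
    hB (Isogeny.nonempty_symm_holds_of_isElliptic W' W) hf0 hf

variable (W W') in
/-- **Faltings' Korollar 2 for elliptic curves from three named facts — symmetric bridge,
Finiteness I, dictionary.** For Weierstrass curves `W, W'` over `K` and a prime `ℓ`, the named
fact `isIsogenous_iff_exists_tateModule_hom_ne_zero W W' ℓ` (for `E, E'` elliptic over a number
field `K`: `E ~_K E'` iff there is a non-zero `Γ_K`-equivariant `ℤ_ℓ`-linear `T_ℓ E → T_ℓ E'`;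
Faltings 1983, §5, Korollar 2) follows from: symmetric bridge data for elliptic `(W, W')`
(`nonempty_abelianVarietyBridge_symm W W'`; a number field is perfect), Faltings' Finiteness I
(`finite_isoClasses_isogenous P`) and the lattice/isogeny dictionary
(`exists_isogeny_range_tateModuleMap_eq P ℓ`), each for every abelian variety `P` over `K`.
Products (`exists_binaryBicone_total_holds`), `T_ℓ` of the bridged surface free of finite rank
(`module_free_tateModule_pt`, `module_finite_tateModule_pt`) and the dual isogeny are theorems.
Proof: the lattice lemma for the vertex of a total bicone on `(B.A, B.A')`
(`tateSubspaceRealization_of_finitenessI`), then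
`isIsogenous_iff_exists_tateModule_hom_ne_zero_of_bridge_of_tateSubspaceRealization`. Compare
`isIsogenous_iff_exists_tateModule_hom_ne_zero_of_finitenessI_quotient`
(`FaltingsECSubspacesHomOfAbelianVarietyProofs`), which goes through Korollar 1 and needs the
full bridge `nonempty_abelianVarietyBridgeFull W W'`.
[cite: Faltings1983Endlichkeit, §5 Korollar 2 (i)⇔(ii)] -/
theorem isIsogenous_iff_exists_tateModule_hom_ne_zero_of_finitenessI_of_bridge_symm
    (hbridge : nonempty_abelianVarietyBridge_symm W W')
    (hfin : ∀ P : AbelianVariety K, finite_isoClasses_isogenous P)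
    (hlat : ∀ P : AbelianVariety K, exists_isogeny_range_tateModuleMap_eq P ℓ) :
    isIsogenous_iff_exists_tateModule_hom_ne_zero W W' ℓ := by
  intro _ _ _
  haveI : PerfectField K := PerfectField.ofCharZero
  obtain ⟨B, hB⟩ := (nonempty_abelianVarietyBridge_symm_iff W W').1 hbridge
  obtain ⟨b, hb⟩ := exists_binaryBicone_total_holds B.A B.A'
  exact isIsogenous_iff_exists_tateModule_hom_ne_zero_of_bridge_of_tateSubspaceRealization W W' ℓ
    B (fun f hf ↦ by obtain ⟨ψ, -⟩ := hB f hf; exact ⟨ψ⟩) b hb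
    (fun {_} ↦ tateSubspaceRealization_of_finitenessI b.pt ℓ (hfin b.pt) (hlat b.pt)
      (module_free_tateModule_pt ℓ B b hb) (module_finite_tateModule_pt ℓ B b hb))

variable (W W') in
/-- **Faltings' Korollar 2 for elliptic curves from three named facts — symmetric bridge,
Finiteness I, quotients.** As
`isIsogenous_iff_exists_tateModule_hom_ne_zero_of_finitenessI_of_bridge_symm`, with the
dictionary supplied by the quotient fact `exists_quotient_isogeny P ℓ` (quotients of an abelian
variety by finite `Γ_K`-stable subgroups with the factorisation of `[ℓⁿ]`; Mumford §7 Thm. 4;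
Kieffer 2024, Prop. 1.1.10, 1.1.12–1.1.13) through
`exists_isogeny_range_tateModuleMap_eq_of_quotient`. With the discharges of
`nonempty_abelianVarietyBridge_symm`, `finite_isoClasses_isogenous` and `exists_quotient_isogeny`
this is `isIsogenous_iff_exists_tateModule_hom_ne_zero_holds`.
[cite: Faltings1983Endlichkeit, §5 Korollar 2 (i)⇔(ii)] -/
theorem isIsogenous_iff_exists_tateModule_hom_ne_zero_of_finitenessI_of_bridge_symm_of_quotient
    (hbridge : nonempty_abelianVarietyBridge_symm W W')
    (hfin : ∀ P : AbelianVariety K, finite_isoClasses_isogenous P)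
    (hquot : ∀ P : AbelianVariety K, exists_quotient_isogeny P ℓ) :
    isIsogenous_iff_exists_tateModule_hom_ne_zero W W' ℓ :=
  isIsogenous_iff_exists_tateModule_hom_ne_zero_of_finitenessI_of_bridge_symm W W' ℓ hbridge hfin
    fun P ↦ exists_isogeny_range_tateModuleMap_eq_of_quotient P ℓ (hquot P)

end Literature.AlgebraicGeometry.Motives
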